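import Literature.MathematicalPhysics.QuantumManyBody.InsertionStateIdentities
import HarnessLib

/-!
# Crux `CorrectorClosure` (stmt-AtomisticToContinuum-12058), line `residue-area-law` —
# registered stub `stub_floorOfRelEntropy`: the entropy lever `exp(−KL(q‖p)) ≤ A` at fixed `N`, `L`

Supports (does not close) stmt-AtomisticToContinuum-12058, route `BECInsertionCorrector`.

**Statement.** Fix `N`, a box `L > 0`, a continuous positive `Θ₀ : Config N → ℝ` with
`∫_{cell^N} Θ₀² = 1` and a continuous positive `Φ₀ : Config (N + 1) → ℝ`. With the FLAT density
`q(X) = L⁻³ Θ₀(vecTail X)²` (a probability density on `cell^{N+1}`) and the DRESSED density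
`p(X) = Φ₀(X)²`,
`exp(−∫_{cell^{N+1}} q log(q/p)) ≤ A := L⁻³ (∫_{cell^N} Θ₀(X) ∫_cell Φ₀(x, X) dx dX)²`
(`stub_floorOfRelEntropy`, the registered signature verbatim). The right-hand side is the square
of the Bhattacharyya coefficient `BC = ∫ √(pq)` of the pair, and the inequality is
`D_{1/2}(q‖p) = −2 log BC ≤ D₁(q‖p) = KL(q‖p)` (monotonicity of the Rényi divergences in the
order) — here for densities that need not both be normalised: only `∫ q = 1` is used, so the
periodicity hypotheses and `∫ Φ₀² = 1` of the registered signature are redundant. The twin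
`floorOfRelEntropy_swap` (`exp(−KL(p‖q)) ≤ A`, which uses `∫ Φ₀² = 1` instead) is the same
argument with the two densities exchanged.

**Proof.** The core is `fre_exp_neg_relEntropy_le_sq`: for continuous positive `f`, `g` on
`Config M` with `∫_{cell^M} f² = 1`, `exp(−∫ f² log(f²/g²)) ≤ (∫ f g)²`. Put
`a = ∫ f²(log g − log f) = −½ KL`; the elementary inequality `log t ≤ t − 1` at
`t = g/(f e^a) > 0`, multiplied by `f² ≥ 0`, reads `f²(log g − log f) − a f² ≤ e^{−a} f g − f²`
pointwise; all four terms are continuous, hence integrable on the bounded cell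
(`integrableOn_cellN`), and integrating gives `a − a · 1 ≤ e^{−a} ∫fg − 1`, i.e. `e^a ≤ ∫ f g`;
squaring, `e^{−KL} = e^{2a} ≤ (∫ f g)²`. No measure-theoretic Jensen inequality and no
compactness/periodicity bound is needed. The stub is the case `M = N + 1`,
`f = θ := s · Θ₀ ∘ vecTail` with `s = √(L⁻³)` (so `q = θ²`), `g = Φ₀`: Fubini along the tagged
particle (`setIntegral_cellN_succ_right_of_continuous`, here as `fre_setIntegral_tail_mul` and
`fre_setIntegral_tail_sq` with `|cell| = L³`) gives `∫ θ² = L⁻³ · L³ · ∫ Θ₀² = 1` and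
`∫ θ Φ₀ = s ∫_{cell^N} Θ₀ ∫_cell Φ₀(x, ·)`, whose square is `A`.

What is NOT here: any `N`-uniform bound on `KL(q‖p)` or `KL(p‖q)` (that is the heart
`stub_residueFloor` in entropy form).

## References

* [VanervenHarremoes2014] T. van Erven, P. Harremoës, *Rényi divergence and Kullback–Leibler
  divergence*, IEEE Trans. Inf. Theory 60 (2014): Thm 3 (`D_α` is nondecreasing in `α`;
  `D_{1/2} = −2 log BC`).
* [GuentherEtAl2021] N.-E. Guenther et al., Phys. Rev. A 103 (2021) 013317: eq. (10) (the residue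
  `Z` as a squared overlap).
-/

noncomputable section

open MeasureTheory Filter Matrix
open scoped ENNReal NNReal BigOperators

namespace Summit.AtomisticToContinuum.BoseEinsteinCondensation.Theorems.CorrectorClosure.ResidueAreaLaw

open Literature.MathematicalPhysics.QuantumManyBody.BoseGas

variable {N : ℕ} {L : ℝ}

/-! ### Fubini along the tagged particle -/

/-- **Pairing of a flat (tail) factor with an `(N+1)`-body function** (Fubini
`[0,L)^{3(N+1)} ≅ [0,L)³ × [0,L)^{3N}`, tagged coordinate innermost):
`∫_{cell^{N+1}} Θ(vecTail X) Φ(X) dX = ∫_{cell^N} Θ(Y) (∫_cell Φ(x, Y) dx) dY` for continuous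
`Θ`, `Φ`. [folklore] -/
theorem fre_setIntegral_tail_mul {Θ : Config N → ℝ} (hΘ : Continuous Θ)
    {Φ : Config (N + 1) → ℝ} (hΦ : Continuous Φ) :
    ∫ X in cellN (N + 1) L, Θ (vecTail X) * Φ X =
      ∫ Y in cellN N L, Θ Y * ∫ x in cell L, Φ (vecCons x Y) := by
  have ht : Continuous (vecTail : Config (N + 1) → Config N) :=
    continuous_pi fun j => continuous_apply j.succ
  have hc : Continuous fun X : Config (N + 1) => Θ (vecTail X) * Φ X := (hΘ.comp ht).mul hΦ
  rw [setIntegral_cellN_succ_right_of_continuous hc]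
  refine integral_congr_ae (Eventually.of_forall fun Y => ?_)
  simp only [Matrix.tail_cons]
  exact integral_const_mul _ _

/-- **Mass of a flat (tail) density**: `∫_{cell^{N+1}} Θ(vecTail X)² dX = L³ ∫_{cell^N} Θ²` for
continuous `Θ` and `L ≥ 0` (Fubini along the tagged particle, `|[0,L)³| = L³`). [folklore] -/
theorem fre_setIntegral_tail_sq (hL : 0 ≤ L) {Θ : Config N → ℝ} (hΘ : Continuous Θ) :
    ∫ X in cellN (N + 1) L, Θ (vecTail X) ^ 2 = L ^ 3 * ∫ Y in cellN N L, Θ Y ^ 2 := by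
  have ht : Continuous (vecTail : Config (N + 1) → Config N) :=
    continuous_pi fun j => continuous_apply j.succ
  have hc : Continuous fun X : Config (N + 1) => Θ (vecTail X) ^ 2 := (hΘ.comp ht).pow 2
  rw [setIntegral_cellN_succ_right_of_continuous hc, ← integral_const_mul]
  refine integral_congr_ae (Eventually.of_forall fun Y => ?_)
  simp only [Matrix.tail_cons, setIntegral_const, smul_eq_mul, measureReal_def, volume_cell,
    ENNReal.toReal_pow, ENNReal.toReal_ofReal hL]

/-! ### The Bhattacharyya–Kullback–Leibler inequality on the cell -/

/-- **`exp(−KL(f²‖g²)) ≤ (∫ f g)²` on the cell.** For continuous positive `f`, `g` on `Config M`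
with `∫_{cell^M} f² = 1`,
`exp(−∫_{cell^M} f² log(f²/g²)) ≤ (∫_{cell^M} f g)²` — the Rényi-order monotonicity
`D_{1/2} = −2 log BC ≤ D₁ = KL` for the densities `f²`, `g²` (the second one need not be
normalised). Proof without Jensen: with `a = ∫ f²(log g − log f) = −½ KL`, the inequality
`log t ≤ t − 1` at `t = g/(f e^a) > 0` times `f² ≥ 0` reads
`f²(log g − log f) − a f² ≤ e^{−a} f g − f²`; every term is continuous, hence integrable on the
bounded cell (`integrableOn_cellN`), and integrating gives `0 ≤ e^{−a} ∫fg − 1`, i.e.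
`e^a ≤ ∫ f g`, whence `e^{−KL} = (e^a)² ≤ (∫ f g)²`.
[cite: VanervenHarremoes2014, Thm 3 (D_{1/2} = −2 log BC ≤ D₁ = KL)] -/
theorem fre_exp_neg_relEntropy_le_sq {M : ℕ} (L : ℝ) {f g : Config M → ℝ} (hf : Continuous f)
    (hg : Continuous g) (hfp : ∀ X, 0 < f X) (hgp : ∀ X, 0 < g X)
    (hfn : ∫ X in cellN M L, f X ^ 2 = 1) :
    Real.exp (-(∫ X in cellN M L, f X ^ 2 * Real.log (f X ^ 2 / g X ^ 2))) ≤
      (∫ X in cellN M L, f X * g X) ^ 2 := by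
  -- `a = ∫ f² (log g − log f) = −½ KL`
  obtain ⟨a, ha⟩ : ∃ a : ℝ,
      a = ∫ X in cellN M L, f X ^ 2 * (Real.log (g X) - Real.log (f X)) := ⟨_, rfl⟩
  have hKL : (∫ X in cellN M L, f X ^ 2 * Real.log (f X ^ 2 / g X ^ 2)) = -2 * a := by
    rw [ha, ← integral_const_mul]
    refine integral_congr_ae (Eventually.of_forall fun X => ?_)
    show f X ^ 2 * Real.log (f X ^ 2 / g X ^ 2) =
      -2 * (f X ^ 2 * (Real.log (g X) - Real.log (f X)))
    rw [Real.log_div (pow_pos (hfp X) 2).ne' (pow_pos (hgp X) 2).ne', Real.log_pow,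
      Real.log_pow]
    push_cast
    ring
  -- the pointwise inequality `log t ≤ t - 1` at `t = g / (f e^a)`, times `f²`
  have hpt : ∀ X, f X ^ 2 * (Real.log (g X) - Real.log (f X)) - a * f X ^ 2 ≤
      (Real.exp a)⁻¹ * (f X * g X) - f X ^ 2 := by
    intro X
    have hf0 := hfp X
    have hg0 := hgp X
    have hc0 := Real.exp_pos a
    have hfne : f X ≠ 0 := hf0.ne'
    have hcne : Real.exp a ≠ 0 := hc0.ne'
    have h1 := Real.log_le_sub_one_of_pos (div_pos hg0 (mul_pos hf0 hc0))
    rw [Real.log_div hg0.ne' (mul_pos hf0 hc0).ne', Real.log_mul hfne hcne,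
      Real.log_exp] at h1
    have h2 := mul_le_mul_of_nonneg_left h1 (sq_nonneg (f X))
    calc f X ^ 2 * (Real.log (g X) - Real.log (f X)) - a * f X ^ 2
        = f X ^ 2 * (Real.log (g X) - (Real.log (f X) + a)) := by ring
      _ ≤ f X ^ 2 * (g X / (f X * Real.exp a) - 1) := h2
      _ = (Real.exp a)⁻¹ * (f X * g X) - f X ^ 2 := by field_simp
  -- integrate over the cell: every term is continuous, hence integrable on the bounded cell
  have hlg : Continuous fun X => Real.log (g X) := hg.log fun X => (hgp X).ne'
  have hlf : Continuous fun X => Real.log (f X) := hf.log fun X => (hfp X).ne'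
  have hi1 : IntegrableOn (fun X => f X ^ 2 * (Real.log (g X) - Real.log (f X)))
      (cellN M L) := integrableOn_cellN ((hf.pow 2).mul (hlg.sub hlf)) L
  have hi2 : IntegrableOn (fun X => a * f X ^ 2) (cellN M L) :=
    integrableOn_cellN (continuous_const.mul (hf.pow 2)) L
  have hi3 : IntegrableOn (fun X => (Real.exp a)⁻¹ * (f X * g X)) (cellN M L) :=
    integrableOn_cellN (continuous_const.mul (hf.mul hg)) L
  have hi4 : IntegrableOn (fun X => f X ^ 2) (cellN M L) := integrableOn_cellN (hf.pow 2) L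
  have hint : ∫ X in cellN M L, (f X ^ 2 * (Real.log (g X) - Real.log (f X)) - a * f X ^ 2) ≤
      ∫ X in cellN M L, ((Real.exp a)⁻¹ * (f X * g X) - f X ^ 2) :=
    integral_mono (hi1.sub hi2) (hi3.sub hi4) fun X => hpt X
  rw [integral_sub hi1 hi2, integral_sub hi3 hi4, integral_const_mul, integral_const_mul, hfn,
    ← ha] at hint
  -- `e^a ≤ BC = ∫ f g`
  have hcB : Real.exp a ≤ ∫ X in cellN M L, f X * g X := by
    have h1 : 1 ≤ (Real.exp a)⁻¹ * ∫ X in cellN M L, f X * g X := by linarith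
    have h2 := mul_le_mul_of_nonneg_left h1 (Real.exp_pos a).le
    rwa [mul_one, ← mul_assoc, mul_inv_cancel₀ (Real.exp_pos a).ne', one_mul] at h2
  -- conclude: `e^{-KL} = (e^a)² ≤ BC²`
  rw [hKL, show Real.exp (-(-2 * a)) = Real.exp a ^ 2 by
    rw [neg_mul, neg_neg, two_mul, Real.exp_add, sq]]
  exact pow_le_pow_left₀ (Real.exp_pos a).le hcB 2

/-! ### The stub and its twin -/

/-- **Registered stub `stub_floorOfRelEntropy` of line `residue-area-law` — the entropy lever at
fixed `N`, `L`.** Let `L > 0`, `Θ₀` a continuous positive function on `Config N` with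
`∫_{cell^N} Θ₀² = 1` and `Φ₀` a continuous positive function on `Config (N+1)`. With the FLAT
density `q(X) = L⁻³ Θ₀(vecTail X)²` and the DRESSED density `p(X) = Φ₀(X)²` on `cell^{N+1}` one has
`exp(−∫_{cell^{N+1}} q log(q/p)) ≤ L⁻³ (∫_{cell^N} Θ₀(X) ∫_cell Φ₀(x, X) dx dX)²`: the insertion
overlap `L^{-3/2}∫Θ₀(X')Φ₀(X) dX = ∫√(pq)` is the Bhattacharyya coefficient `BC` of `p` and `q`
(Fubini along the tagged particle, `fre_setIntegral_tail_mul`; `∫ q = 1` by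
`fre_setIntegral_tail_sq`), and `log BC ≥ ∫ q log √(p/q) = −½ KL(q‖p)`
(`fre_exp_neg_relEntropy_le_sq`, from `log t ≤ t − 1` integrated against `q`). The periodicity
hypotheses and the normalisation `∫ Φ₀² = 1` of the registered signature are not used (the bound
holds for every positive continuous `Φ₀`). Third sufficient condition for the heart
`stub_residueFloor`: an `N`-uniform bound `KL(q‖p) ≤ K` gives the residue floor `e^{-K}`.
[cite: VanervenHarremoes2014, Thm 3 (D_{1/2} = −2 log BC ≤ D₁ = KL)] -/
theorem stub_floorOfRelEntropy (N : ℕ) (L : ℝ) (hL : 0 < L)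
    (Θ₀ : Config N → ℝ) (hΘc : Continuous Θ₀) (hΘp : ∀ X, 0 < Θ₀ X)
    (hΘper : ∀ (X : Config N) (i : Fin N) (k : Fin 3),
      Θ₀ (X + Pi.single i (EuclideanSpace.single k L)) = Θ₀ X)
    (hΘn : ∫ X in cellN N L, Θ₀ X ^ 2 = 1)
    (Φ₀ : Config (N + 1) → ℝ) (hΦc : Continuous Φ₀) (hΦp : ∀ X, 0 < Φ₀ X)
    (hΦper : ∀ (X : Config (N + 1)) (i : Fin (N + 1)) (k : Fin 3),
      Φ₀ (X + Pi.single i (EuclideanSpace.single k L)) = Φ₀ X)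
    (hΦn : ∫ X in cellN (N + 1) L, Φ₀ X ^ 2 = 1) :
    ENNReal.ofReal (Real.exp (-(∫ X in cellN (N + 1) L,
        ((L ^ 3)⁻¹ * Θ₀ (vecTail X) ^ 2) *
          Real.log (((L ^ 3)⁻¹ * Θ₀ (vecTail X) ^ 2) / Φ₀ X ^ 2)))) ≤
      ENNReal.ofReal ((L ^ 3)⁻¹ *
        (∫ X in cellN N L, Θ₀ X * ∫ x in cell L, Φ₀ (vecCons x X)) ^ 2) := by
  have _ := hΘper -- redundant hypotheses of the registered signature: only `∫ q = 1`,
  have _ := hΦper -- continuity and positivity are used (no compactness/periodicity bound,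
  have _ := hΦn -- and the dressed density need not be normalised)
  refine ENNReal.ofReal_le_ofReal ?_
  -- constants: `s = √(L⁻³)`; the flat amplitude `θ = s · Θ₀ ∘ vecTail` (`q = θ²`)
  have hL3 : 0 < L ^ 3 := by positivity
  have hL3i : 0 < (L ^ 3)⁻¹ := inv_pos.2 hL3
  obtain ⟨s, hs0, hs2⟩ : ∃ s : ℝ, 0 < s ∧ s ^ 2 = (L ^ 3)⁻¹ :=
    ⟨Real.sqrt ((L ^ 3)⁻¹), Real.sqrt_pos.2 hL3i, Real.sq_sqrt hL3i.le⟩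
  have ht : Continuous (vecTail : Config (N + 1) → Config N) :=
    continuous_pi fun j => continuous_apply j.succ
  obtain ⟨θ, hθ⟩ : ∃ θ : Config (N + 1) → ℝ, θ = fun X => s * Θ₀ (vecTail X) := ⟨_, rfl⟩
  have hθX : ∀ X, θ X = s * Θ₀ (vecTail X) := fun X => by rw [hθ]
  have hθp : ∀ X, 0 < θ X := fun X => by rw [hθX]; exact mul_pos hs0 (hΘp _)
  have hθc : Continuous θ := by rw [hθ]; exact continuous_const.mul (hΘc.comp ht)
  have hq : ∀ X, (L ^ 3)⁻¹ * Θ₀ (vecTail X) ^ 2 = θ X ^ 2 := fun X => by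
    rw [hθX, mul_pow, hs2]
  -- mass `∫ θ² = 1` and the Bhattacharyya coefficient `∫ θ Φ₀ = s · ∫ Θ₀ ∫_cell Φ₀`
  have hmass : ∫ X in cellN (N + 1) L, θ X ^ 2 = 1 := by
    simp_rw [← hq]
    rw [integral_const_mul, fre_setIntegral_tail_sq hL.le hΘc, hΘn, mul_one,
      inv_mul_cancel₀ hL3.ne']
  have hBC : ∫ X in cellN (N + 1) L, θ X * Φ₀ X =
      s * ∫ Y in cellN N L, Θ₀ Y * ∫ x in cell L, Φ₀ (vecCons x Y) := by
    have h : ∀ X, θ X * Φ₀ X = s * (Θ₀ (vecTail X) * Φ₀ X) := fun X => by rw [hθX, mul_assoc]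
    simp_rw [h]
    rw [integral_const_mul, fre_setIntegral_tail_mul hΘc hΦc]
  -- the cell inequality for `f = θ`, `g = Φ₀`
  have hqi : (∫ X in cellN (N + 1) L, ((L ^ 3)⁻¹ * Θ₀ (vecTail X) ^ 2) *
      Real.log (((L ^ 3)⁻¹ * Θ₀ (vecTail X) ^ 2) / Φ₀ X ^ 2)) =
      ∫ X in cellN (N + 1) L, θ X ^ 2 * Real.log (θ X ^ 2 / Φ₀ X ^ 2) := by
    simp_rw [hq]
  rw [hqi]
  calc Real.exp (-(∫ X in cellN (N + 1) L, θ X ^ 2 * Real.log (θ X ^ 2 / Φ₀ X ^ 2)))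
      ≤ (∫ X in cellN (N + 1) L, θ X * Φ₀ X) ^ 2 :=
        fre_exp_neg_relEntropy_le_sq L hθc hΦc hθp hΦp hmass
    _ = (L ^ 3)⁻¹ * (∫ X in cellN N L, Θ₀ X * ∫ x in cell L, Φ₀ (vecCons x X)) ^ 2 := by
        rw [hBC, ← hs2]; ring

/-- **The twin entropy lever, `exp(−KL(p‖q)) ≤ A`.** In the setting of `stub_floorOfRelEntropy`
(`L > 0`, `Θ₀`, `Φ₀` continuous and positive) but now with the DRESSED density normalised,
`∫_{cell^{N+1}} Φ₀² = 1`, the relative entropy the other way round also floors the insertion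
residue: `exp(−∫_{cell^{N+1}} p log(p/q)) ≤ L⁻³ (∫_{cell^N} Θ₀(X) ∫_cell Φ₀(x, X) dx dX)²` with
`p = Φ₀²`, `q = L⁻³ Θ₀(vecTail ·)²` — the same Bhattacharyya bound `fre_exp_neg_relEntropy_le_sq`
with the roles of the two densities swapped (here `∫ Θ₀² = 1` is not needed).
[cite: VanervenHarremoes2014, Thm 3 (D_{1/2} = −2 log BC ≤ D₁ = KL)] -/
theorem floorOfRelEntropy_swap (N : ℕ) (L : ℝ) (hL : 0 < L)
    (Θ₀ : Config N → ℝ) (hΘc : Continuous Θ₀) (hΘp : ∀ X, 0 < Θ₀ X)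
    (Φ₀ : Config (N + 1) → ℝ) (hΦc : Continuous Φ₀) (hΦp : ∀ X, 0 < Φ₀ X)
    (hΦn : ∫ X in cellN (N + 1) L, Φ₀ X ^ 2 = 1) :
    ENNReal.ofReal (Real.exp (-(∫ X in cellN (N + 1) L,
        Φ₀ X ^ 2 * Real.log (Φ₀ X ^ 2 / ((L ^ 3)⁻¹ * Θ₀ (vecTail X) ^ 2))))) ≤
      ENNReal.ofReal ((L ^ 3)⁻¹ *
        (∫ X in cellN N L, Θ₀ X * ∫ x in cell L, Φ₀ (vecCons x X)) ^ 2) := by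
  refine ENNReal.ofReal_le_ofReal ?_
  -- constants: `s = √(L⁻³)`; the flat amplitude `θ = s · Θ₀ ∘ vecTail` (`q = θ²`)
  have hL3 : 0 < L ^ 3 := by positivity
  have hL3i : 0 < (L ^ 3)⁻¹ := inv_pos.2 hL3
  obtain ⟨s, hs0, hs2⟩ : ∃ s : ℝ, 0 < s ∧ s ^ 2 = (L ^ 3)⁻¹ :=
    ⟨Real.sqrt ((L ^ 3)⁻¹), Real.sqrt_pos.2 hL3i, Real.sq_sqrt hL3i.le⟩
  have ht : Continuous (vecTail : Config (N + 1) → Config N) :=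
    continuous_pi fun j => continuous_apply j.succ
  obtain ⟨θ, hθ⟩ : ∃ θ : Config (N + 1) → ℝ, θ = fun X => s * Θ₀ (vecTail X) := ⟨_, rfl⟩
  have hθX : ∀ X, θ X = s * Θ₀ (vecTail X) := fun X => by rw [hθ]
  have hθp : ∀ X, 0 < θ X := fun X => by rw [hθX]; exact mul_pos hs0 (hΘp _)
  have hθc : Continuous θ := by rw [hθ]; exact continuous_const.mul (hΘc.comp ht)
  have hq : ∀ X, (L ^ 3)⁻¹ * Θ₀ (vecTail X) ^ 2 = θ X ^ 2 := fun X => by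
    rw [hθX, mul_pow, hs2]
  -- the Bhattacharyya coefficient `∫ Φ₀ θ = s · ∫ Θ₀ ∫_cell Φ₀`
  have hBC : ∫ X in cellN (N + 1) L, Φ₀ X * θ X =
      s * ∫ Y in cellN N L, Θ₀ Y * ∫ x in cell L, Φ₀ (vecCons x Y) := by
    have h : ∀ X, Φ₀ X * θ X = s * (Θ₀ (vecTail X) * Φ₀ X) := fun X => by rw [hθX]; ring
    simp_rw [h]
    rw [integral_const_mul, fre_setIntegral_tail_mul hΘc hΦc]
  -- the cell inequality for `f = Φ₀`, `g = θ`
  have hqi : (∫ X in cellN (N + 1) L,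
      Φ₀ X ^ 2 * Real.log (Φ₀ X ^ 2 / ((L ^ 3)⁻¹ * Θ₀ (vecTail X) ^ 2))) =
      ∫ X in cellN (N + 1) L, Φ₀ X ^ 2 * Real.log (Φ₀ X ^ 2 / θ X ^ 2) := by
    simp_rw [hq]
  rw [hqi]
  calc Real.exp (-(∫ X in cellN (N + 1) L, Φ₀ X ^ 2 * Real.log (Φ₀ X ^ 2 / θ X ^ 2)))
      ≤ (∫ X in cellN (N + 1) L, Φ₀ X * θ X) ^ 2 :=
        fre_exp_neg_relEntropy_le_sq L hΦc hθc hΦp hθp hΦn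
    _ = (L ^ 3)⁻¹ * (∫ X in cellN N L, Θ₀ X * ∫ x in cell L, Φ₀ (vecCons x X)) ^ 2 := by
        rw [hBC, ← hs2]; ring

end Summit.AtomisticToContinuum.BoseEinsteinCondensation.Theorems.CorrectorClosure.ResidueAreaLaw

end
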